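import Summits.QuantumFields.YangMills.Theorems.BalabanUVNodesN12RootedForestLam
import Summits.QuantumFields.YangMills.Theorems.BalabanUVNodesN12ForestSlice
import Summits.QuantumFields.YangMills.Theorems.BalabanUVNodesN12FlatHndHarmonicLetterB
import HarnessLib

/-!
# BalabanUVNodes ∕ N12 — (β)♭ ON THE FOREST SLICE AT A BOND-LEVEL DATUM `𝔅` and at PRINT's datum `lamBondsSeq Ω k` ([II] (2.3)): dag-n12-w3's `…N12ForestSlice` §1 RE-ROOTED at the
# print tower sites — modulo the harmonic letter (L♭) on `𝔅`'s bonds (displayed) and the connectivity letter (C) (DISCHARGED for (N)(B)(S) sequences by this seat's `…RootedForestLam` §3)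

[Balaban1989LargeFieldII] = «[16]», (1.9) p. 358, p. 359 (the flat Hessian ∕ (β)); [Balaban1985Variational] = «[15]», (4) p. 278 (the residual group), (16)–(18) p. 280;
[Balaban1988Convergent] = «[III]», (2.2) p. 255, (2.10)–(2.13) pp. 256–257; [Balaban1984PropagatorsII] = «[II]», (2.3) p. 224 (print's `Λ_j`: fewer constrained bonds, fewer roots).

Cell `pub-ymgap` (HUMAN RULINGS D-0062 ∕ D-0149), WIDTH SEAT `pub-ymgap-dag-n12-w6` g24 (node N12 = [B15]; key K1⁹ `stmt-QuantumFields-27364`, `--kind proof --supports … --as helper`;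
count-neutral).  THEOREMS ONLY (0 `def`, 0 `instance`, 0 `sorry`); by name over: dag-n12-d g32's ᴮ twins `…FlatFibreNullSpaceDetSetB.iterLin_eq_zero_of_fderiv_msChart_one_eq_zero_detSet`
(the kernel of `DΦ_𝔅(0)` kills the iterated linearised averages at `𝔅`'s bonds) and `…FlatHndHarmonicLetterB.exists_locConstGauge_of_plaq_eq_zero_of_iterLin_eq_zero_of_harmonic` (under
(L♭) a curl-free field with vanishing constrained averages is a locally-constant gradient), dag-n12-w3∕w4's datum-free `N12FlatChartHnd.coe_plaq_eq_zero_of_deriv_deriv_eq_zero` ∕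
`deriv_deriv_wilsonAction4_expChart_one_nonneg` ∕ `N12FlatHndRecordLetters.deriv_deriv_eq_zero_of_fderiv_fderiv_diag_eq_zero`, and this seat's ✓p776028 `…RootedForestLam`
(`grad_eq_zero_of_forest_of_locConst_bDetSet`, `hconn_lamBondsSeq_of_nested`).  The second (F)-file of the (ii) split (dag-n12-d g32 ∕ dag-n12-w6 g24).

WHY.  w3's (β)♭ on the forest slice — «a slice vector in `ker DΦ(0)` with vanishing flat second variation is `0`» — is the non-degeneracy input of the (J0′)∕direct road's per-base-field
letters at the FLAT background; at print's datum the slice is the forest slice rooted at the PRINT tower sites (✓p776028) and the chart is `msChartB … (lamBondsSeq Ω k)`.  The proof is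
w3's verbatim: `DΦ_𝔅(0)X = 0` kills `Q^{(j)}↑X` at `𝔅`'s bonds, the flat second variation makes `↑X` curl-free, (L♭) makes it a locally-constant gradient `dφ₀` with `φ₀` constant along
`𝔅`'s bonds at the tower sites, and the re-rooted transversality ends it.  Two letters: (C) — discharged for (N)(B)(S) by ✓p767987 through ✓p776028 §3 — and (L♭) on `𝔅`'s bonds, which at
print's datum is NOT the (b)-letter `harmonic_Bj` (fewer constrained bonds) and is left DISPLAYED (`hharm`) for the successor's `harmonic_lamBondsSeq`.

CONTENTS (namespace `Summit.QuantumFields.YangMills.BalabanUVNodes.N12ForestSliceLam`): §1 bond datum: ★★★ `eq_zero_of_fderiv_msChartB_one_eq_zero_of_forest_of_harmonic`; §2 print,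
(N)(B)(S): ★★★ `eq_zero_of_fderiv_msChartB_one_eq_zero_of_forest_lamBondsSeq_nested` ((C) discharged, (L♭) displayed), ★★ `deriv_deriv_pos_of_fderiv_msChartB_one_eq_zero_of_forest_lamBondsSeq_nested`,
★★★ `hnondeg_real_flat_forest_lamBondsSeq_nested` (dag-n12-w1's real `hnondeg` letter shape on the print forest slice); §3 (v1.1) (L♭) DISCHARGED by
dag-n12-d's `harmonic_lamBondsSeq_nested`: ★★★ `eq_zero_of_fderiv_msChartB_one_eq_zero_of_printForest`, ★★ `deriv_deriv_pos_of_fderiv_msChartB_one_eq_zero_of_printForest`, ★★★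
`hnondeg_real_flat_printForest` — letter-free for every (N)(B)(S) sequence.

HONEST FRAMING.  Linear algebra by name over landed kernel theorems; (L♭) at print's datum NOT discharged here; nothing of Bałaban's estimates asserted or refuted; count-neutral helper;
N12 NOT discharged; K0⁷∕K1⁹ NOT closed; counts of record unmoved; one finite 𝕋⁴ programme at fixed ε — R4 closes the conditional rung `BalabanLadder.UV` only; the Yang–Mills mass gap
(Clay) is NOT proved by any of this; nothing continuum ∕ ℝ⁴ ∕ OS.
-/

noncomputable section

namespace Summit.QuantumFields.YangMills.BalabanUVNodes.N12ForestSliceLam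

open scoped BigOperators Matrix.Norms.L2Operator Topology
open Literature.MathematicalPhysics.QuantumFieldTheory.Balaban1983to89
open T4Continuum
open B15DeterminingSets B15DeterminingSetsB
open BlockAveragingEMLLinearised (linAvg)
open T4AdjointCovarianceUnitary (lieSU)
open Node00 hiding blockIter
open B14.Eq22Determines (blockIter IsBlockUnion)
open Summit.QuantumFields.YangMills.BalabanUVNodes.N12RootedForestLam (grad_eq_zero_of_forest_of_locConst_bDetSet hconn_lamBondsSeq_of_nested)
open Summit.QuantumFields.YangMills.BalabanUVNodes.N12FlatFibreNullSpaceDetSetB (iterLin_eq_zero_of_fderiv_msChart_one_eq_zero_detSet)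
open Summit.QuantumFields.YangMills.BalabanUVNodes.N12FlatHndHarmonicLetterB (exists_locConstGauge_of_plaq_eq_zero_of_iterLin_eq_zero_of_harmonic)
open N12FlatChartHnd (coe_plaq_eq_zero_of_deriv_deriv_eq_zero deriv_deriv_wilsonAction4_expChart_one_nonneg)

variable {F : T4Family} {N : ℕ} [NeZero N] {K k : ℕ}

/-! ## §1  (β)♭ on the forest slice at a bond-level datum, modulo (L♭) and (C) -/

/-- ★★★ **(β)♭ AT NODE 00's FLAT BOND-DATUM CHART ON THE FOREST SLICE, GENERAL `𝔅`, MODULO (L♭) AND (C)**: for a forest in which every site off `R(𝔅, k)` hangs (TREE), a field `X` vanishing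
on every path bond with `DΦ_𝔅(0)X = 0` (`Φ_𝔅 = msChartB … 𝔅 (M˙1) 1`) and `d²∕ds² A(e^{sX})|₀ = 0` is `0` — w3's `…ForestSlice` :71 with `bondsOf (𝐁 j)` ↦ `𝔅 j` and the ᴮ chart.
[cite: Balaban1989LargeFieldII, (1.9) p.358, p.359; Balaban1985Variational, (4) p.278, (16)–(18) p.280; Balaban1988Convergent, (2.2) p.255, (2.10)–(2.13) pp.256–257] -/
theorem eq_zero_of_fderiv_msChartB_one_eq_zero_of_forest_of_harmonic (𝔅 : BDetSet (F.P K))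
    (hharm : ∀ (φ₀ : Site (F.P K) 0 → Matrix (Fin N) (Fin N) ℂ) (A : Fin (F.P K).d → Matrix (Fin N) (Fin N) ℂ),
      (∀ j, j ≤ k → ∀ c ∈ 𝔅 j, φ₀ (embIter j c.tgt) - φ₀ (embIter j c.src) + ((F.P K).L ^ j : ℕ) • A c.dir = 0) → ∀ μ, A μ = 0)
    (hconn : ∀ ψ : Site (F.P K) 0 → Matrix (Fin N) (Fin N) ℂ, (∀ j, j ≤ k → ∀ c ∈ 𝔅 j, ψ (embIter j c.tgt) = ψ (embIter j c.src)) →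
      ∀ j j', j ≤ k → j' ≤ k → ∀ c ∈ 𝔅 j, ∀ c' ∈ 𝔅 j', ψ (embIter j c.src) = ψ (embIter j' c'.src))
    {path : Site (F.P K) 0 → List (LStep (F.P K) 0)}
    (htree : ∀ x : Site (F.P K) 0, x ∉ {z : Site (F.P K) 0 | ∃ j, j ≤ k ∧ ∃ c ∈ 𝔅 j, (z = embIter j c.src ∨ z = embIter j c.tgt)} →
      ∃ (x' : Site (F.P K) 0) (s : LStep (F.P K) 0), path x = path x' ++ [s] ∧
        (s.fwd = true → s.bond.src = x' ∧ s.bond.tgt = x) ∧ (s.fwd = false → s.bond.src = x ∧ s.bond.tgt = x'))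
    {X : PBond (F.P K) 0 → lieSU (Fin N)} (hax : ∀ x, ∀ s ∈ path x, X s.bond = 0)
    (hker : fderiv ℝ (msChartB F N K k 𝔅 (avgFamily (avOfRecord F N K) (1 : GaugeField (F.P K) 0 (SU N))) (1 : GaugeField (F.P K) 0 (SU N))) 0 X = 0)
    (hflat : deriv (deriv fun s : ℝ => wilsonAction4 (expChart (1 : GaugeField (F.P K) 0 (SU N)) (s • X))) 0 = 0) :
    X = 0 := by
  obtain ⟨Q, hQ0, hQs⟩ : ∃ Q : (i : ℕ) → (PBond (F.P K) 0 → Matrix (Fin N) (Fin N) ℂ) → PBond (F.P K) i → Matrix (Fin N) (Fin N) ℂ,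
      (∀ Y, Q 0 Y = Y) ∧ ∀ (i : ℕ) (Y : PBond (F.P K) 0 → Matrix (Fin N) (Fin N) ℂ) (c : PBond (F.P K) (i + 1)), Q (i + 1) Y c = linAvg (Q i Y) c :=
    ⟨fun i => Nat.rec (motive := fun i => (PBond (F.P K) 0 → Matrix (Fin N) (Fin N) ℂ) → PBond (F.P K) i → Matrix (Fin N) (Fin N) ℂ) (fun Y => Y)
      (fun _ Qi Y c => linAvg (Qi Y) c) i, fun _ => rfl, fun _ _ _ => rfl⟩
  have hQ : ∀ j, j ≤ k → ∀ c ∈ 𝔅 j, Q j (fun b => (X b : Matrix (Fin N) (Fin N) ℂ)) c = 0 := fun j hj c hc =>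
    iterLin_eq_zero_of_fderiv_msChart_one_eq_zero_detSet Q hQ0 hQs 𝔅 hker hj hc
  obtain ⟨φ₀, hφ₀, hXφ₀⟩ := exists_locConstGauge_of_plaq_eq_zero_of_iterLin_eq_zero_of_harmonic Q hQ0 hQs 𝔅 k hharm
    (fun b => (X b : Matrix (Fin N) (Fin N) ℂ)) (coe_plaq_eq_zero_of_deriv_deriv_eq_zero X hflat) hQ
  have hgrad := grad_eq_zero_of_forest_of_locConst_bDetSet 𝔅 k htree hconn φ₀ hφ₀ fun x s hs =>
    sub_eq_zero.1 (by rw [← hXφ₀ s.bond, hax x s hs]; rfl)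
  funext b
  exact Subtype.ext (by rw [hXφ₀ b, hgrad b]; rfl)

/-! ## §2  PRINT's datum, (N)(B)(S) sequences: (C) discharged, (L♭) displayed -/

section Print

variable {Ω : ℕ → Set (Site (F.P K) 0)}

/-- ★★★ **(β)♭ ON THE PRINT-ROOTED FOREST SLICE FOR EVERY (N)(B)(S) SEQUENCE, CURVE FORM** (`1 ≤ k ≤ m + K`): (C) ← this seat's `hconn_lamBondsSeq_of_nested` (✓p767987 through ✓p776028);
LEFT DISPLAYED: the harmonic letter (L♭) on print's bonds (`hharm`), (TREE) for the forest (`…RootedForestLam.exists_rootedForest_lamBondsSeq` supplies it), the slice membership, the kernel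
letter for `msChartB … (lamBondsSeq Ω k) (M˙1) 1`, the flat second variation. [cite: Balaban1984PropagatorsII, (2.3) p.224; Balaban1989LargeFieldII, (1.9) p.358, p.359; Balaban1985Variational, (4) p.278; Balaban1988Convergent, (2.2) p.255, (2.13) pp.256–257] -/
theorem eq_zero_of_fderiv_msChartB_one_eq_zero_of_forest_lamBondsSeq_nested (hk1 : 1 ≤ k) (hk : k ≤ (F.P K).m + (F.P K).K)
    (hnest : ∀ j, 1 ≤ j → j < k → Ω (j + 1) ⊆ Ω j) (hBU : ∀ j, 1 ≤ j → j ≤ k → IsBlockUnion j (Ω j))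
    (hsep : ∀ j, 1 ≤ j → j + 1 ≤ k → ∀ (x z : Site (F.P K) 0) (μ : Fin (F.P K).d), (z = x.shift μ ∨ x = z.shift μ) → z ∈ Ω (j + 1) →
      ∀ y : Site (F.P K) 0, blockIter (j + 1) y = blockIter (j + 1) x → y ∈ Ω j)
    (hharm : ∀ (φ₀ : Site (F.P K) 0 → Matrix (Fin N) (Fin N) ℂ) (A : Fin (F.P K).d → Matrix (Fin N) (Fin N) ℂ),
      (∀ j, j ≤ k → ∀ c ∈ lamBondsSeq Ω k j, φ₀ (embIter j c.tgt) - φ₀ (embIter j c.src) + ((F.P K).L ^ j : ℕ) • A c.dir = 0) → ∀ μ, A μ = 0)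
    {path : Site (F.P K) 0 → List (LStep (F.P K) 0)}
    (htree : ∀ x : Site (F.P K) 0, x ∉ {z : Site (F.P K) 0 | ∃ j, j ≤ k ∧ ∃ c ∈ lamBondsSeq Ω k j, (z = embIter j c.src ∨ z = embIter j c.tgt)} →
      ∃ (x' : Site (F.P K) 0) (s : LStep (F.P K) 0), path x = path x' ++ [s] ∧
        (s.fwd = true → s.bond.src = x' ∧ s.bond.tgt = x) ∧ (s.fwd = false → s.bond.src = x ∧ s.bond.tgt = x'))
    {X : PBond (F.P K) 0 → lieSU (Fin N)} (hax : ∀ x, ∀ s ∈ path x, X s.bond = 0)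
    (hker : fderiv ℝ (msChartB F N K k (lamBondsSeq Ω k) (avgFamily (avOfRecord F N K) (1 : GaugeField (F.P K) 0 (SU N))) (1 : GaugeField (F.P K) 0 (SU N))) 0 X = 0)
    (hflat : deriv (deriv fun s : ℝ => wilsonAction4 (expChart (1 : GaugeField (F.P K) 0 (SU N)) (s • X))) 0 = 0) :
    X = 0 :=
  eq_zero_of_fderiv_msChartB_one_eq_zero_of_forest_of_harmonic (lamBondsSeq Ω k) hharm
    (fun ψ hψ => hconn_lamBondsSeq_of_nested hk1 hk hnest hBU hsep ψ hψ) htree hax hker hflat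

/-- ★★ **POSITIVITY FORM AT PRINT's DATUM**: a nonzero `X` in the print forest slice with `DΦ_𝔅(0)X = 0` has `0 < d²∕ds² A(e^{sX})|₀` ((N)(B)(S); (L♭) displayed).
[cite: Balaban1984PropagatorsII, (2.3) p.224; Balaban1989LargeFieldII, (1.9) p.358, p.359; Balaban1985Variational, (4) p.278] -/
theorem deriv_deriv_pos_of_fderiv_msChartB_one_eq_zero_of_forest_lamBondsSeq_nested (hk1 : 1 ≤ k) (hk : k ≤ (F.P K).m + (F.P K).K)
    (hnest : ∀ j, 1 ≤ j → j < k → Ω (j + 1) ⊆ Ω j) (hBU : ∀ j, 1 ≤ j → j ≤ k → IsBlockUnion j (Ω j))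
    (hsep : ∀ j, 1 ≤ j → j + 1 ≤ k → ∀ (x z : Site (F.P K) 0) (μ : Fin (F.P K).d), (z = x.shift μ ∨ x = z.shift μ) → z ∈ Ω (j + 1) →
      ∀ y : Site (F.P K) 0, blockIter (j + 1) y = blockIter (j + 1) x → y ∈ Ω j)
    (hharm : ∀ (φ₀ : Site (F.P K) 0 → Matrix (Fin N) (Fin N) ℂ) (A : Fin (F.P K).d → Matrix (Fin N) (Fin N) ℂ),
      (∀ j, j ≤ k → ∀ c ∈ lamBondsSeq Ω k j, φ₀ (embIter j c.tgt) - φ₀ (embIter j c.src) + ((F.P K).L ^ j : ℕ) • A c.dir = 0) → ∀ μ, A μ = 0)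
    {path : Site (F.P K) 0 → List (LStep (F.P K) 0)}
    (htree : ∀ x : Site (F.P K) 0, x ∉ {z : Site (F.P K) 0 | ∃ j, j ≤ k ∧ ∃ c ∈ lamBondsSeq Ω k j, (z = embIter j c.src ∨ z = embIter j c.tgt)} →
      ∃ (x' : Site (F.P K) 0) (s : LStep (F.P K) 0), path x = path x' ++ [s] ∧
        (s.fwd = true → s.bond.src = x' ∧ s.bond.tgt = x) ∧ (s.fwd = false → s.bond.src = x ∧ s.bond.tgt = x'))
    {X : PBond (F.P K) 0 → lieSU (Fin N)} (hX0 : X ≠ 0) (hax : ∀ x, ∀ s ∈ path x, X s.bond = 0)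
    (hker : fderiv ℝ (msChartB F N K k (lamBondsSeq Ω k) (avgFamily (avOfRecord F N K) (1 : GaugeField (F.P K) 0 (SU N))) (1 : GaugeField (F.P K) 0 (SU N))) 0 X = 0) :
    0 < deriv (deriv fun s : ℝ => wilsonAction4 (expChart (1 : GaugeField (F.P K) 0 (SU N)) (s • X))) 0 :=
  lt_of_le_of_ne (deriv_deriv_wilsonAction4_expChart_one_nonneg X) fun h =>
    hX0 (eq_zero_of_fderiv_msChartB_one_eq_zero_of_forest_lamBondsSeq_nested hk1 hk hnest hBU hsep hharm htree hax hker h.symm)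

/-- ★★★ **THE FLAT REAL `hnondeg` LETTER ON THE PRINT FOREST SLICE, EVERY (N)(B)(S) SEQUENCE** (the bilinear shape of dag-n12-w1's (β) before complexification, w3's :130 re-rooted): `s` in the
print forest slice and in `ker DΦ_𝔅(0)` whose flat Hessian against every such slice vector vanishes is `0` (only `t = s` is used; (L♭) displayed).
[cite: Balaban1984PropagatorsII, (2.3) p.224; Balaban1989LargeFieldII, (1.9) p.358, p.359; Balaban1985Variational, (4) p.278, (16)–(18) p.280] -/
theorem hnondeg_real_flat_forest_lamBondsSeq_nested (hk1 : 1 ≤ k) (hk : k ≤ (F.P K).m + (F.P K).K)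
    (hnest : ∀ j, 1 ≤ j → j < k → Ω (j + 1) ⊆ Ω j) (hBU : ∀ j, 1 ≤ j → j ≤ k → IsBlockUnion j (Ω j))
    (hsep : ∀ j, 1 ≤ j → j + 1 ≤ k → ∀ (x z : Site (F.P K) 0) (μ : Fin (F.P K).d), (z = x.shift μ ∨ x = z.shift μ) → z ∈ Ω (j + 1) →
      ∀ y : Site (F.P K) 0, blockIter (j + 1) y = blockIter (j + 1) x → y ∈ Ω j)
    (hharm : ∀ (φ₀ : Site (F.P K) 0 → Matrix (Fin N) (Fin N) ℂ) (A : Fin (F.P K).d → Matrix (Fin N) (Fin N) ℂ),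
      (∀ j, j ≤ k → ∀ c ∈ lamBondsSeq Ω k j, φ₀ (embIter j c.tgt) - φ₀ (embIter j c.src) + ((F.P K).L ^ j : ℕ) • A c.dir = 0) → ∀ μ, A μ = 0)
    {path : Site (F.P K) 0 → List (LStep (F.P K) 0)}
    (htree : ∀ x : Site (F.P K) 0, x ∉ {z : Site (F.P K) 0 | ∃ j, j ≤ k ∧ ∃ c ∈ lamBondsSeq Ω k j, (z = embIter j c.src ∨ z = embIter j c.tgt)} →
      ∃ (x' : Site (F.P K) 0) (s : LStep (F.P K) 0), path x = path x' ++ [s] ∧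
        (s.fwd = true → s.bond.src = x' ∧ s.bond.tgt = x) ∧ (s.fwd = false → s.bond.src = x ∧ s.bond.tgt = x'))
    (s : PBond (F.P K) 0 → lieSU (Fin N)) (hs : ∀ x, ∀ u ∈ path x, s u.bond = 0)
    (hker : fderiv ℝ (msChartB F N K k (lamBondsSeq Ω k) (avgFamily (avOfRecord F N K) (1 : GaugeField (F.P K) 0 (SU N))) (1 : GaugeField (F.P K) 0 (SU N))) 0 s = 0)
    (hq : ∀ t : PBond (F.P K) 0 → lieSU (Fin N), (∀ x, ∀ u ∈ path x, t u.bond = 0) →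
      fderiv ℝ (msChartB F N K k (lamBondsSeq Ω k) (avgFamily (avOfRecord F N K) (1 : GaugeField (F.P K) 0 (SU N))) (1 : GaugeField (F.P K) 0 (SU N))) 0 t = 0 →
      fderiv ℝ (fun Y => fderiv ℝ (fun Y : PBond (F.P K) 0 → lieSU (Fin N) => wilsonAction4 (expChart (1 : GaugeField (F.P K) 0 (SU N)) Y)) Y) 0 s t = 0) :
    s = 0 :=
  eq_zero_of_fderiv_msChartB_one_eq_zero_of_forest_lamBondsSeq_nested hk1 hk hnest hBU hsep hharm htree hs hker
    (N12FlatHndRecordLetters.deriv_deriv_eq_zero_of_fderiv_fderiv_diag_eq_zero s (hq s hs hker))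

end Print

/-! ## §3  (v1.1, APPEND-ONLY) (L♭) DISCHARGED: (β)♭ on the print-rooted forest slice, LETTER-FREE for every (N)(B)(S) sequence (dag-n12-d's `harmonic_lamBondsSeq_nested`) -/

section PrintFree

open Summit.QuantumFields.YangMills.BalabanUVNodes.N12FlatHndHarmonicLetterB (harmonic_lamBondsSeq_nested)

variable {Ω : ℕ → Set (Site (F.P K) 0)}

/-- ★★★ **(β)♭ ON THE PRINT-ROOTED FOREST SLICE, LETTER-FREE, EVERY (N)(B)(S) SEQUENCE** (`1 ≤ k ≤ m + K`): a field in the print forest slice with `DΦ_𝔅(0)X = 0` (`𝔅 = lamBondsSeq Ω k`,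
flat base point) and vanishing flat second variation is `0` — §2 with (L♭) `hharm := harmonic_lamBondsSeq_nested hk1 hk hnest hBU` (dag-n12-d g32, `…FlatHndHarmonicLetterB` v1.1) and (C)
already discharged there. [cite: Balaban1984PropagatorsII, (2.3) p.224; Balaban1989LargeFieldII, (1.9) p.358, p.359; Balaban1985Variational, (4) p.278; Balaban1988Convergent, (2.2) p.255, (2.13) pp.256–257] -/
theorem eq_zero_of_fderiv_msChartB_one_eq_zero_of_printForest (hk1 : 1 ≤ k) (hk : k ≤ (F.P K).m + (F.P K).K)
    (hnest : ∀ j, 1 ≤ j → j < k → Ω (j + 1) ⊆ Ω j) (hBU : ∀ j, 1 ≤ j → j ≤ k → IsBlockUnion j (Ω j))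
    (hsep : ∀ j, 1 ≤ j → j + 1 ≤ k → ∀ (x z : Site (F.P K) 0) (μ : Fin (F.P K).d), (z = x.shift μ ∨ x = z.shift μ) → z ∈ Ω (j + 1) →
      ∀ y : Site (F.P K) 0, blockIter (j + 1) y = blockIter (j + 1) x → y ∈ Ω j)
    {path : Site (F.P K) 0 → List (LStep (F.P K) 0)}
    (htree : ∀ x : Site (F.P K) 0, x ∉ {z : Site (F.P K) 0 | ∃ j, j ≤ k ∧ ∃ c ∈ lamBondsSeq Ω k j, (z = embIter j c.src ∨ z = embIter j c.tgt)} →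
      ∃ (x' : Site (F.P K) 0) (s : LStep (F.P K) 0), path x = path x' ++ [s] ∧
        (s.fwd = true → s.bond.src = x' ∧ s.bond.tgt = x) ∧ (s.fwd = false → s.bond.src = x ∧ s.bond.tgt = x'))
    {X : PBond (F.P K) 0 → lieSU (Fin N)} (hax : ∀ x, ∀ s ∈ path x, X s.bond = 0)
    (hker : fderiv ℝ (msChartB F N K k (lamBondsSeq Ω k) (avgFamily (avOfRecord F N K) (1 : GaugeField (F.P K) 0 (SU N))) (1 : GaugeField (F.P K) 0 (SU N))) 0 X = 0)
    (hflat : deriv (deriv fun s : ℝ => wilsonAction4 (expChart (1 : GaugeField (F.P K) 0 (SU N)) (s • X))) 0 = 0) :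
    X = 0 :=
  eq_zero_of_fderiv_msChartB_one_eq_zero_of_forest_lamBondsSeq_nested hk1 hk hnest hBU hsep
    (fun φ₀ A hφ => harmonic_lamBondsSeq_nested hk1 hk hnest hBU φ₀ A hφ) htree hax hker hflat

/-- ★★ **POSITIVITY FORM, LETTER-FREE**: a nonzero `X` in the print forest slice with `DΦ_𝔅(0)X = 0` has `0 < d²∕ds² A(e^{sX})|₀`, every (N)(B)(S) sequence.
[cite: Balaban1984PropagatorsII, (2.3) p.224; Balaban1989LargeFieldII, (1.9) p.358, p.359; Balaban1985Variational, (4) p.278] -/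
theorem deriv_deriv_pos_of_fderiv_msChartB_one_eq_zero_of_printForest (hk1 : 1 ≤ k) (hk : k ≤ (F.P K).m + (F.P K).K)
    (hnest : ∀ j, 1 ≤ j → j < k → Ω (j + 1) ⊆ Ω j) (hBU : ∀ j, 1 ≤ j → j ≤ k → IsBlockUnion j (Ω j))
    (hsep : ∀ j, 1 ≤ j → j + 1 ≤ k → ∀ (x z : Site (F.P K) 0) (μ : Fin (F.P K).d), (z = x.shift μ ∨ x = z.shift μ) → z ∈ Ω (j + 1) →
      ∀ y : Site (F.P K) 0, blockIter (j + 1) y = blockIter (j + 1) x → y ∈ Ω j)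
    {path : Site (F.P K) 0 → List (LStep (F.P K) 0)}
    (htree : ∀ x : Site (F.P K) 0, x ∉ {z : Site (F.P K) 0 | ∃ j, j ≤ k ∧ ∃ c ∈ lamBondsSeq Ω k j, (z = embIter j c.src ∨ z = embIter j c.tgt)} →
      ∃ (x' : Site (F.P K) 0) (s : LStep (F.P K) 0), path x = path x' ++ [s] ∧
        (s.fwd = true → s.bond.src = x' ∧ s.bond.tgt = x) ∧ (s.fwd = false → s.bond.src = x ∧ s.bond.tgt = x'))
    {X : PBond (F.P K) 0 → lieSU (Fin N)} (hX0 : X ≠ 0) (hax : ∀ x, ∀ s ∈ path x, X s.bond = 0)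
    (hker : fderiv ℝ (msChartB F N K k (lamBondsSeq Ω k) (avgFamily (avOfRecord F N K) (1 : GaugeField (F.P K) 0 (SU N))) (1 : GaugeField (F.P K) 0 (SU N))) 0 X = 0) :
    0 < deriv (deriv fun s : ℝ => wilsonAction4 (expChart (1 : GaugeField (F.P K) 0 (SU N)) (s • X))) 0 :=
  deriv_deriv_pos_of_fderiv_msChartB_one_eq_zero_of_forest_lamBondsSeq_nested hk1 hk hnest hBU hsep
    (fun φ₀ A hφ => harmonic_lamBondsSeq_nested hk1 hk hnest hBU φ₀ A hφ) htree hX0 hax hker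

/-- ★★★ **THE FLAT REAL `hnondeg` LETTER ON THE PRINT FOREST SLICE, LETTER-FREE, EVERY (N)(B)(S) SEQUENCE** (dag-n12-w1's (β) shape before complexification; only `t = s` is used).
[cite: Balaban1984PropagatorsII, (2.3) p.224; Balaban1989LargeFieldII, (1.9) p.358, p.359; Balaban1985Variational, (4) p.278, (16)–(18) p.280] -/
theorem hnondeg_real_flat_printForest (hk1 : 1 ≤ k) (hk : k ≤ (F.P K).m + (F.P K).K)
    (hnest : ∀ j, 1 ≤ j → j < k → Ω (j + 1) ⊆ Ω j) (hBU : ∀ j, 1 ≤ j → j ≤ k → IsBlockUnion j (Ω j))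
    (hsep : ∀ j, 1 ≤ j → j + 1 ≤ k → ∀ (x z : Site (F.P K) 0) (μ : Fin (F.P K).d), (z = x.shift μ ∨ x = z.shift μ) → z ∈ Ω (j + 1) →
      ∀ y : Site (F.P K) 0, blockIter (j + 1) y = blockIter (j + 1) x → y ∈ Ω j)
    {path : Site (F.P K) 0 → List (LStep (F.P K) 0)}
    (htree : ∀ x : Site (F.P K) 0, x ∉ {z : Site (F.P K) 0 | ∃ j, j ≤ k ∧ ∃ c ∈ lamBondsSeq Ω k j, (z = embIter j c.src ∨ z = embIter j c.tgt)} →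
      ∃ (x' : Site (F.P K) 0) (s : LStep (F.P K) 0), path x = path x' ++ [s] ∧
        (s.fwd = true → s.bond.src = x' ∧ s.bond.tgt = x) ∧ (s.fwd = false → s.bond.src = x ∧ s.bond.tgt = x'))
    (s : PBond (F.P K) 0 → lieSU (Fin N)) (hs : ∀ x, ∀ u ∈ path x, s u.bond = 0)
    (hker : fderiv ℝ (msChartB F N K k (lamBondsSeq Ω k) (avgFamily (avOfRecord F N K) (1 : GaugeField (F.P K) 0 (SU N))) (1 : GaugeField (F.P K) 0 (SU N))) 0 s = 0)
    (hq : ∀ t : PBond (F.P K) 0 → lieSU (Fin N), (∀ x, ∀ u ∈ path x, t u.bond = 0) →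
      fderiv ℝ (msChartB F N K k (lamBondsSeq Ω k) (avgFamily (avOfRecord F N K) (1 : GaugeField (F.P K) 0 (SU N))) (1 : GaugeField (F.P K) 0 (SU N))) 0 t = 0 →
      fderiv ℝ (fun Y => fderiv ℝ (fun Y : PBond (F.P K) 0 → lieSU (Fin N) => wilsonAction4 (expChart (1 : GaugeField (F.P K) 0 (SU N)) Y)) Y) 0 s t = 0) :
    s = 0 :=
  hnondeg_real_flat_forest_lamBondsSeq_nested hk1 hk hnest hBU hsep
    (fun φ₀ A hφ => harmonic_lamBondsSeq_nested hk1 hk hnest hBU φ₀ A hφ) htree s hs hker hq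

end PrintFree

end Summit.QuantumFields.YangMills.BalabanUVNodes.N12ForestSliceLam

end
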